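import Summits.Ventures.PercRepro.RLSRuleThreePoint

/-!
# PercRepro — the lifted rule `R₃⁺` at `t = 0` on LINE-FREE planes: `U_{3,g}` for every `g` and every `p`
(night-3, gen 3)

The `t = 0, P₂` half of the lane (`proofs/N3-R3PLUS-plan.md` §1) for the planes WITHOUT a `3`-point line, in the
kernel: on such a plane `G` (every `3`-subset independent: `LineFree`), every rank-`3` subset `B′ ⊆ G` pays `Φ(p, 3)` by
itself, because in a witness `B′ ∪ X` (`X` independent, off `G`) no competitor trace has more than `2 + 3` points or a
`4`-point line, so either every trace is in `𝒯₀` (`|B′| ≤ 5`; share `C(b, 3)/ρ₃(B′ ∪ X) ≥ C(b, 3)/C(b + x, 3)`) or `B′`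
itself is the unique trace outside `𝒯₀` (`|B′| ≥ 6`; share `1`) — and `C(b, 3) · C(x + 3, 3) ≥ C(b + x, 3)`
(`choose_three_mul_choose_three_ge`) makes both at least the triple share `1 / C(x + 3, 3)`.  No loss case occurs.

* `LineFree`, `rho3_eq_choose_of_lineFree`, `lineFree_subset`, `eRk_eq_three_of_lineFree_card`;
* `not_hasLongLine_of_lineFree_union`, `card_inter_le_two_of_lineFree`, `card_inter_le_five_of_lineFree`,
  `mstar_union_eq_zero_of_lineFree`, `tied_eq_singleton_of_lineFree`;
* `wPlus_union_ge_of_lineFree`: the share of `G` in `B′ ∪ X` is at least `1 / C(3 + |X|, 3)`;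
* the witnesses and the per-flat inequality itself (`witnessFamily`, `sum_witness_eq_phiK`,
  `perFlat_lineFree_of_typeZero`) are in the sequel `RLSRuleLineFreeMain.lean`.
Imports `RLSRuleThreePoint`.  Axioms: standard.
-/

open scoped Matroid

namespace PercRepro

namespace NightThree

open Finset ThmH PerFlat

variable {α : Type*} [DecidableEq α] {M : Matroid α} [M.Finite]

/-! ### Line-free sets -/

/-- A finset is LINE-FREE when every `3` of its points are independent (no `3`-point line). -/
def LineFree (M : Matroid α) (G : Finset α) : Prop := ∀ T ∈ G.powersetCard 3, M.Indep (T : Set α)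

omit [DecidableEq α] [M.Finite] in
/-- Subsets of line-free sets are line-free. -/
theorem lineFree_subset {G B : Finset α} (h : LineFree M G) (hB : B ⊆ G) : LineFree M B :=
  fun T hT => h T (Finset.powersetCard_mono hB hT)

omit [DecidableEq α] [M.Finite] in
/-- On a line-free set every triple counts: `ρ₃ = C(|B|, 3)`. -/
theorem rho3_eq_choose_of_lineFree {B : Finset α} (h : LineFree M B) : rho3 M B = B.card.choose 3 := by
  classical
  unfold rho3
  rw [Finset.filter_true_of_mem (fun T hT => h T hT), Finset.card_powersetCard]

omit [DecidableEq α] in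
/-- A line-free set with at least `3` points, inside a plane, has rank `3`. -/
theorem eRk_eq_three_of_lineFree_card {G B : Finset α} (hG : G ∈ flatsQ M 3) (hB : B ⊆ G)
    (hfree : LineFree M B) (hc : 3 ≤ B.card) : M.eRk (B : Set α) = 3 := by
  obtain ⟨T, hTB, hTc⟩ := Finset.exists_subset_card_eq hc
  have hT : M.Indep (T : Set α) := hfree T (Finset.mem_powersetCard.2 ⟨hTB, hTc⟩)
  apply le_antisymm
  · rw [← eRk_eq_three_of_mem_flatsQ' hG]
    exact M.eRk_mono (Finset.coe_subset.2 hB)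
  · rw [← eRk_eq_three_of_indep_card hT hTc]
    exact M.eRk_mono (Finset.coe_subset.2 hTB)

omit [DecidableEq α] [M.Finite] in
/-- Two points of a line-free set with at least `3` points have rank `2`. -/
theorem eRk_pair_of_lineFree {G P : Finset α} (hfree : LineFree M G) (hc : 3 ≤ G.card) (hP : P ⊆ G)
    (hPc : P.card = 2) : M.eRk (P : Set α) = 2 := by
  obtain ⟨T, hPT, hTG, hTc⟩ := Finset.exists_subsuperset_card_eq hP (by omega) hc
  have hT : M.Indep (T : Set α) := hfree T (Finset.mem_powersetCard.2 ⟨hTG, hTc⟩)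
  rw [eRk_eq_card_of_indep (hT.subset (Finset.coe_subset.2 hPT)), hPc]
  rfl

/-! ### The traces of a witness `B′ ∪ X` -/

/-- **No long line in `B′ ∪ X`** for `B′` inside a line-free plane `G` and an independent `X` off `G`. -/
theorem not_hasLongLine_of_lineFree_union {G X : Finset α} (hG : G ∈ flatsQ M 3) (hfree : LineFree M G)
    (hX : M.Indep (X : Set α)) {F : Finset α} (hF : F ⊆ G ∪ X) :
    ¬ HasLongLine M F := by
  rintro ⟨L, hL, hr⟩
  rw [Finset.mem_powersetCard] at hL
  obtain ⟨hLF, hLc⟩ := hL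
  have hLGX : L ⊆ G ∪ X := hLF.trans hF
  have hGE : (G : Set α) ⊆ M.E := by rw [← coe_gr M]; exact Finset.coe_subset.2 (mem_flatsQ.1 hG).1
  have hLE : (L : Set α) ⊆ M.E := by
    refine (Finset.coe_subset.2 hLGX).trans ?_
    rw [Finset.coe_union]
    exact Set.union_subset hGE hX.subset_ground
  have hGc : 3 ≤ G.card := three_le_card_of_eRk_eq_three (eRk_eq_three_of_mem_flatsQ' hG)
  -- at most two points of `L` lie in `X`
  have hLX : (L ∩ X).card ≤ 2 := by
    have hind : M.Indep ((L ∩ X : Finset α) : Set α) :=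
      hX.subset (Finset.coe_subset.2 Finset.inter_subset_right)
    have h2 : M.eRk ((L ∩ X : Finset α) : Set α) ≤ 2 :=
      (M.eRk_mono (Finset.coe_subset.2 Finset.inter_subset_left)).trans hr
    rw [eRk_eq_card_of_indep hind] at h2
    exact_mod_cast h2
  -- so at least two lie in `G`
  have hLG : 2 ≤ (L ∩ G).card := by
    have hsplit : L = (L ∩ G) ∪ (L ∩ X) := by
      rw [← Finset.inter_union_distrib_left, Finset.inter_eq_left.2 hLGX]
    have hc := Finset.card_union_le (L ∩ G) (L ∩ X)
    rw [← hsplit, hLc] at hc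
    omega
  obtain ⟨P, hPsub, hPc⟩ := Finset.exists_subset_card_eq hLG
  have hPG : P ⊆ G := hPsub.trans Finset.inter_subset_right
  have hPL : P ⊆ L := hPsub.trans Finset.inter_subset_left
  have hPr : M.eRk (P : Set α) = 2 := eRk_pair_of_lineFree hfree hGc hPG hPc
  -- `L` lies in the closure of the two points `P ⊆ G`, hence in `G`
  have hcl : M.closure (P : Set α) = M.closure (L : Set α) := by
    apply closure_eq_of_subset_flat (M.isFlat_closure _)
      ((Finset.coe_subset.2 hPL).trans (M.subset_closure _ hLE)) P.finite_toSet
    rw [M.eRk_closure_eq, hPr]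
    exact hr
  have hGflat : M.IsFlat (G : Set α) := (mem_flatsQ.1 hG).2.1
  have hLsub : L ⊆ G := by
    rw [← Finset.coe_subset]
    calc (L : Set α) ⊆ M.closure (L : Set α) := M.subset_closure _ hLE
      _ = M.closure (P : Set α) := hcl.symm
      _ ⊆ M.closure (G : Set α) := M.closure_subset_closure (Finset.coe_subset.2 hPG)
      _ = (G : Set α) := hGflat.closure
  -- a `4`-point subset of the line-free `G` contains an independent triple: rank `≥ 3`
  obtain ⟨T, hTL, hTc⟩ := Finset.exists_subset_card_eq (show 3 ≤ L.card by omega)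
  have hT : M.Indep (T : Set α) := hfree T (Finset.mem_powersetCard.2 ⟨hTL.trans hLsub, hTc⟩)
  have h3 : M.eRk (T : Set α) ≤ 2 := (M.eRk_mono (Finset.coe_subset.2 hTL)).trans hr
  rw [eRk_eq_three_of_indep_card hT hTc] at h3
  exact absurd h3 (by norm_num)

/-- A plane `G' ≠ G` meets a line-free plane `G` in at most `2` points. -/
theorem card_inter_le_two_of_lineFree {G G' : Finset α} (hG : G ∈ flatsQ M 3) (hfree : LineFree M G)
    (hG' : G' ∈ flatsQ M 3) (hne : G' ≠ G) : (G' ∩ G).card ≤ 2 := by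
  by_contra h
  push Not at h
  obtain ⟨T, hT, hTc⟩ := Finset.exists_subset_card_eq (show 3 ≤ (G' ∩ G).card by omega)
  have hTind : M.Indep (T : Set α) :=
    hfree T (Finset.mem_powersetCard.2 ⟨hT.trans Finset.inter_subset_right, hTc⟩)
  have h3 : M.eRk (T : Set α) = 3 := eRk_eq_three_of_indep_card hTind hTc
  have hle : M.eRk ((G' ∩ G : Finset α) : Set α) ≤ 2 := by
    rw [flatsQ_three] at hG hG'
    exact eRk_inter_le_two_of_ne hG' hG hne
  have := (M.eRk_mono (Finset.coe_subset.2 hT)).trans hle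
  rw [h3] at this
  exact absurd this (by norm_num)

/-- A plane `G' ≠ G` meets `B′ ∪ X` (`B′ ⊆ G` line-free, `X` independent) in at most `5` points. -/
theorem card_inter_le_five_of_lineFree {G B X G' : Finset α} (hG : G ∈ flatsQ M 3) (hfree : LineFree M G)
    (hB : B ⊆ G) (hX : M.Indep (X : Set α)) (hG' : G' ∈ flatsQ M 3) (hne : G' ≠ G) :
    (G' ∩ (B ∪ X)).card ≤ 5 := by
  have hG3 : M.eRk (G' : Set α) = 3 := eRk_eq_three_of_mem_flatsQ' hG'
  have h1 : (G' ∩ B).card ≤ 2 :=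
    (Finset.card_le_card (Finset.inter_subset_inter_left hB)).trans
      (card_inter_le_two_of_lineFree hG hfree hG' hne)
  have h2 : (G' ∩ X).card ≤ 3 := by
    have hind : M.Indep ((G' ∩ X : Finset α) : Set α) :=
      hX.subset (Finset.coe_subset.2 Finset.inter_subset_right)
    have h2' : M.eRk ((G' ∩ X : Finset α) : Set α) ≤ 3 := by
      rw [← hG3]
      exact M.eRk_mono (Finset.coe_subset.2 Finset.inter_subset_left)
    rw [eRk_eq_card_of_indep hind] at h2'
    exact_mod_cast h2'
  calc (G' ∩ (B ∪ X)).card = ((G' ∩ B) ∪ (G' ∩ X)).card := by rw [Finset.inter_union_distrib_left]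
    _ ≤ (G' ∩ B).card + (G' ∩ X).card := Finset.card_union_le _ _
    _ ≤ 5 := by omega

/-- The trace of `G` on `B′ ∪ X` is `B′` when `X` is off `G`. -/
theorem inter_union_eq_of_disjoint {G B X : Finset α} (hB : B ⊆ G) (hXG : Disjoint X G) :
    G ∩ (B ∪ X) = B := by
  rw [Finset.inter_union_distrib_left, Finset.inter_eq_right.2 hB,
    Finset.disjoint_iff_inter_eq_empty.1 hXG.symm, Finset.union_empty]

/-- **Every trace of `B′ ∪ X` is in `𝒯₀`** when `|B′| ≤ 5` (`B′` inside a line-free plane, `X` independent and off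
the plane). -/
theorem mstar_union_eq_zero_of_lineFree {G B X : Finset α} (hG : G ∈ flatsQ M 3) (hfree : LineFree M G)
    (hB : B ⊆ G) (hBc : B.card ≤ 5) (hX : M.Indep (X : Set α)) (hXG : Disjoint X G) :
    mstar M (B ∪ X) = 0 := by
  rw [mstar_eq_zero_iff]
  intro G' hG' hn
  obtain ⟨_, hbig⟩ := hn
  have hsub : G' ∩ (B ∪ X) ⊆ G ∪ X :=
    Finset.inter_subset_right.trans (Finset.union_subset_union hB le_rfl)
  rcases hbig with h6 | hline
  · by_cases hGG : G' = G
    · rw [hGG, inter_union_eq_of_disjoint hB hXG] at h6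
      omega
    · have := card_inter_le_five_of_lineFree hG hfree hB hX hG' hGG
      omega
  · exact not_hasLongLine_of_lineFree_union hG hfree hX hsub hline

/-- When `|B′| ≥ 6`, the plane `G` is the UNIQUE tied plane of `B′ ∪ X`: its trace `B′` is outside `𝒯₀` and no other
trace is. -/
theorem tied_eq_singleton_of_lineFree {G B X : Finset α} (hG : G ∈ flatsQ M 3) (hfree : LineFree M G)
    (hB : B ⊆ G) (hBc : 6 ≤ B.card) (hX : M.Indep (X : Set α)) (hXG : Disjoint X G) :
    tied M (B ∪ X) = {G} := by
  have hBtrace : G ∩ (B ∪ X) = B := inter_union_eq_of_disjoint hB hXG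
  have hB3 : M.eRk (B : Set α) = 3 :=
    eRk_eq_three_of_lineFree_card hG hB (lineFree_subset hfree hB) (by omega)
  have hnon : NonT0 M (G ∩ (B ∪ X)) := by
    rw [hBtrace]
    exact ⟨hB3, Or.inl hBc⟩
  -- no other plane has a trace outside `𝒯₀`
  have hother : ∀ G' ∈ flatsQ M 3, G' ≠ G → ¬ NonT0 M (G' ∩ (B ∪ X)) := by
    intro G' hG' hne hn
    obtain ⟨_, hbig⟩ := hn
    rcases hbig with h6 | hline
    · have := card_inter_le_five_of_lineFree hG hfree hB hX hG' hne
      omega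
    · exact not_hasLongLine_of_lineFree_union hG hfree hX
        (Finset.inter_subset_right.trans (Finset.union_subset_union hB le_rfl)) hline
  -- hence `m*` is `|B′|`
  have hm : mstar M (B ∪ X) = (G ∩ (B ∪ X)).card := by
    classical
    unfold mstar
    apply le_antisymm
    · apply Finset.sup_le
      intro G' hG'
      rw [Finset.mem_filter] at hG'
      by_cases hne : G' = G
      · rw [hne]
      · exact absurd hG'.2 (hother G' hG'.1 hne)
    · exact Finset.le_sup (f := fun G' => (G' ∩ (B ∪ X)).card) (Finset.mem_filter.2 ⟨hG, hnon⟩)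
  ext G'
  rw [mem_tied, Finset.mem_singleton]
  constructor
  · rintro ⟨hG', hn, _⟩
    by_contra hne
    exact hother G' hG' hne hn
  · rintro rfl
    exact ⟨hG, hnon, hm.symm⟩

/-! ### The binomial inequality and the share bound -/

/-- `C(m + 3, 3) = (m + 3)(m + 2)(m + 1)/6` in `ℚ`. -/
theorem choose_three_cast_eq (m : ℕ) :
    (((m + 3).choose 3 : ℕ) : ℚ) = ((m : ℚ) + 3) * ((m : ℚ) + 2) * ((m : ℚ) + 1) / 6 := by
  induction m with
  | zero => norm_num
  | succ k ih =>
    rw [show k + 1 + 3 = (k + 3) + 1 by omega, Nat.choose_succ_succ, Nat.cast_add, ih,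
      Nat.choose_two_right]
    have h2 : (((k + 3) * (k + 3 - 1) / 2 : ℕ) : ℚ) = ((k : ℚ) + 3) * ((k : ℚ) + 2) / 2 := by
      rw [show k + 3 - 1 = k + 2 by omega]
      rw [Nat.cast_div (by
        rcases Nat.even_or_odd k with ⟨r, hr⟩ | ⟨r, hr⟩
        · exact ⟨(2 * r + 3) * (r + 1), by subst hr; ring⟩
        · exact ⟨(r + 2) * (2 * r + 3), by subst hr; ring⟩) (by norm_num)]
      push_cast
      ring
    rw [h2]
    push_cast
    ring

/-- **`C(b, 3) · C(x + 3, 3) ≥ C(b + x, 3)` for `b ≥ 3`.** -/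
theorem choose_three_mul_choose_three_ge (m x : ℕ) :
    (((m + 3 + x).choose 3 : ℕ) : ℚ) ≤ (((m + 3).choose 3 : ℕ) : ℚ) * (((x + 3).choose 3 : ℕ) : ℚ) := by
  rw [show m + 3 + x = (m + x) + 3 by omega, choose_three_cast_eq, choose_three_cast_eq, choose_three_cast_eq]
  push_cast
  have hm : (0 : ℚ) ≤ m := by positivity
  have hx : (0 : ℚ) ≤ x := by positivity
  have key : ((m : ℚ) + 3) * ((m : ℚ) + 2) * ((m : ℚ) + 1) / 6 * (((x : ℚ) + 3) * ((x : ℚ) + 2) * ((x : ℚ) + 1) / 6)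
      - ((m : ℚ) + x + 3) * ((m : ℚ) + x + 2) * ((m : ℚ) + x + 1) / 6 =
      (m : ℚ) * x * ((m : ℚ) ^ 2 * x ^ 2 + 6 * m ^ 2 * x + 11 * m ^ 2 + 6 * m * x ^ 2 + 36 * m * x + 48 * m
        + 11 * x ^ 2 + 48 * x + 49) / 36 := by ring
  have hpos : 0 ≤ (m : ℚ) * x * ((m : ℚ) ^ 2 * x ^ 2 + 6 * m ^ 2 * x + 11 * m ^ 2 + 6 * m * x ^ 2 + 36 * m * x
      + 48 * m + 11 * x ^ 2 + 48 * x + 49) / 36 := by positivity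
  linarith

/-- **The share of `G` in `B′ ∪ X`** is at least the triple share `1 / C(3 + |X|, 3)`, for every `B′ ⊆ G` with
`|B′| ≥ 3` (`G` line-free, `X` independent and off `G`). -/
theorem wPlus_union_ge_of_lineFree {G B X : Finset α} (hG : G ∈ flatsQ M 3) (hfree : LineFree M G)
    (hB : B ⊆ G) (hBc : 3 ≤ B.card) (hX : M.Indep (X : Set α)) (hXG : Disjoint X G) :
    1 / (((3 + X.card).choose 3 : ℕ) : ℚ) ≤ wPlus M G (B ∪ X) := by
  have hS : B ∪ X ⊆ gr M := by
    apply Finset.union_subset (hB.trans (mem_flatsQ.1 hG).1)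
    rw [← Finset.coe_subset, coe_gr]
    exact hX.subset_ground
  have hBtrace : G ∩ (B ∪ X) = B := inter_union_eq_of_disjoint hB hXG
  have hXB : Disjoint X B := Finset.disjoint_of_subset_right hB hXG
  rcases le_or_gt B.card 5 with h5 | h6
  · -- every trace in `𝒯₀`: the basis-count share `C(b, 3) / ρ₃(S) ≥ C(b, 3) / C(b + x, 3)`
    have h := wPlus_ge_of_mstar_zero hS (mstar_union_eq_zero_of_lineFree hG hfree hB h5 hX hXG) G
    rw [hBtrace, rho3_eq_choose_of_lineFree (lineFree_subset hfree hB),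
      Finset.card_union_of_disjoint hXB.symm] at h
    refine le_trans ?_ h
    obtain ⟨m, hm⟩ : ∃ m, B.card = m + 3 := ⟨B.card - 3, by omega⟩
    rw [hm, div_le_div_iff₀ (by exact_mod_cast Nat.choose_pos (by omega : 3 ≤ 3 + X.card))
      (by exact_mod_cast Nat.choose_pos (by omega : 3 ≤ m + 3 + X.card)), one_mul, add_comm 3 X.card]
    exact choose_three_mul_choose_three_ge m X.card
  · -- `B′` is the unique trace outside `𝒯₀`: share `1`
    have h1 : wPlus M G (B ∪ X) = 1 := by
      apply wPlus_eq_one_of_unique hS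
      · rw [tied_eq_singleton_of_lineFree hG hfree hB (by omega) hX hXG]
        exact Finset.mem_singleton_self G
      · intro G' hG'
        rw [tied_eq_singleton_of_lineFree hG hfree hB (by omega) hX hXG] at hG'
        exact Finset.mem_singleton.1 hG'
    rw [h1]
    have hpos : (1 : ℚ) ≤ (((3 + X.card).choose 3 : ℕ) : ℚ) := by
      exact_mod_cast Nat.choose_pos (by omega : 3 ≤ 3 + X.card)
    rw [div_le_one (by positivity)]
    exact hpos

end NightThree

end PercRepro
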